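import Summits.QuantumFields.YangMills.Theorems.ScalingWindowSplitSelfNormalisedSkewnessWitnessChart
import Summits.QuantumFields.YangMills.Theorems.ScalingWindowSplitSelfNormalisedSkewnessStubAbelianPushforward
import Summits.QuantumFields.YangMills.Theorems.ScalingWindowSplitSelfNormalisedSkewnessStubTorusTwoFormExact
import HarnessLib

/-!
# `SelfNormalisedSkewness` — negative side: the small-box measure on `V` and the moment dictionary

Route `ScalingWindowSplit`, crux `stmt-QuantumFields-18944`, line `Sketch` (negation branch), support for the
lead's `stub_witnessAssembly`.  With the landed stubs `stub_abelianPushforward` and `stub_torusTwoFormExact` the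
chart identity of `WitnessChart` becomes unconditional.  We package the push-forward of Wilson's `U(1)` measure
restricted to the small-field set `G_ε = {∀p |ω_p| < ε}` as a PROBABILITY measure on `V = im d`:

* `boxV`, `cosWeight`, `boxMeasure`, `boxProb` — the box `{v ∈ V : |v_p| < ε}`, Wilson's weight
  `e^{−β Σ_p (1 − cos v_p)}` read on `V`, the weighted Lebesgue measure of the box and its normalisation;
* `lintegral_goodSet_eq_mul_boxProb` — `∫_{G_ε} F(ω(U)) dμ_β = μ_β(G_ε) · ∫ F d(boxProb)`;
* `abs_integral_sub_integral_boxProb_le` — **moment dictionary**: for an observable `ψ` of the configuration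
  that agrees on `G_ε` with `Ψ ∘ ω` and `|ψ|, |Ψ| ≤ M`: `|E_{μ_β} ψ − E_{boxProb} Ψ| ≤ 2 M μ_β(G_εᶜ)`.

References: Lüscher 1999 §3 (admissible fields); standard.  No definitions of propositions, no named facts.
-/

noncomputable section

open scoped BigOperators ENNReal
open MeasureTheory
open Literature.MathematicalPhysics.QuantumLattice Literature.MathematicalPhysics.QuantumFieldTheory

namespace Summit.QuantumFields.YangMills.Theorems.SelfNormalisedSkewness.Negative

variable {S : ℕ} [NeZero S]

/-- The open `ε`-box of `V = im d`: exact plaquette fields with all coordinates `< ε` in size. [folklore] -/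
def boxV (S : ℕ) [NeZero S] (ε : ℝ) : Set (LinearMap.range (plaqCoboundary S)) :=
  {v | ∀ p : Plaquette 4 S, |(v : EuclideanSpace ℝ (Plaquette 4 S)) p| < ε}

/-- Wilson's `U(1)` weight read on `V`: `e^{−β Σ_p (1 − cos v_p)}`. [folklore] -/
def cosWeight (S : ℕ) [NeZero S] (β : ℝ) (v : LinearMap.range (plaqCoboundary S)) : ℝ :=
  Real.exp (-(β * ∑ p : Plaquette 4 S, (1 - Real.cos ((v : EuclideanSpace ℝ (Plaquette 4 S)) p))))

/-- The weighted Lebesgue measure of the box. [folklore] -/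
def boxMeasure (S : ℕ) [NeZero S] (β ε : ℝ) : Measure (LinearMap.range (plaqCoboundary S)) :=
  ((volume : Measure (LinearMap.range (plaqCoboundary S))).restrict (boxV S ε)).withDensity
    fun v => ENNReal.ofReal (cosWeight S β v)

/-- The normalised box measure (a probability measure, `isProbabilityMeasure_boxProb`). [folklore] -/
def boxProb (S : ℕ) [NeZero S] (β ε : ℝ) : Measure (LinearMap.range (plaqCoboundary S)) :=
  (boxMeasure S β ε Set.univ)⁻¹ • boxMeasure S β ε

omit [NeZero S] in
/-- The coordinate maps of `V` are measurable. [folklore] -/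
theorem measurable_coordV (p : Plaquette 4 S) :
    Measurable fun v : LinearMap.range (plaqCoboundary S) => (v : EuclideanSpace ℝ (Plaquette 4 S)) p :=
  (measurable_pi_apply p).comp ((MeasurableEquiv.toLp 2 (Plaquette 4 S → ℝ)).symm.measurable.comp
    measurable_subtype_coe)

/-- The box is measurable. [folklore] -/
theorem measurableSet_boxV (ε : ℝ) : MeasurableSet (boxV S ε) := by
  have : boxV S ε = ⋂ p : Plaquette 4 S, {v : LinearMap.range (plaqCoboundary S) |
      |(v : EuclideanSpace ℝ (Plaquette 4 S)) p| < ε} := by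
    ext v; simp [boxV]
  rw [this]
  exact MeasurableSet.iInter fun p => measurableSet_lt (measurable_coordV p).abs measurable_const

/-- The weight is measurable. [folklore] -/
theorem measurable_cosWeight (β : ℝ) : Measurable (cosWeight S β) := by
  unfold cosWeight
  refine Real.measurable_exp.comp ((Finset.measurable_sum _ fun p _ => ?_).const_mul _).neg
  exact measurable_const.sub (Real.measurable_cos.comp (measurable_coordV p))

/-- The weight is positive. [folklore] -/
theorem cosWeight_pos (β : ℝ) (v : LinearMap.range (plaqCoboundary S)) : 0 < cosWeight S β v :=
  Real.exp_pos _

/-- The weight is at most one (for `β ≥ 0`). [folklore] -/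
theorem cosWeight_le_one {β : ℝ} (hβ : 0 ≤ β) (v : LinearMap.range (plaqCoboundary S)) : cosWeight S β v ≤ 1 := by
  unfold cosWeight
  rw [Real.exp_le_one_iff, neg_nonpos]
  exact mul_nonneg hβ (Finset.sum_nonneg fun p _ => sub_nonneg.2 (Real.cos_le_one _))

/-- The box has finite volume: it is bounded. [folklore] -/
theorem volume_boxV_lt_top (ε : ℝ) : (volume : Measure (LinearMap.range (plaqCoboundary S))) (boxV S ε) < ∞ := by
  refine (Bornology.IsBounded.measure_lt_top ?_)
  rw [Metric.isBounded_iff_subset_closedBall (0 : LinearMap.range (plaqCoboundary S))]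
  refine ⟨Real.sqrt (Fintype.card (Plaquette 4 S)) * |ε|, fun v hv => ?_⟩
  rw [Metric.mem_closedBall, dist_zero_right, Submodule.coe_norm, EuclideanSpace.norm_eq]
  calc Real.sqrt (∑ p, ‖(v : EuclideanSpace ℝ (Plaquette 4 S)) p‖ ^ 2)
      ≤ Real.sqrt (∑ _p : Plaquette 4 S, |ε| ^ 2) := by
        gcongr with p
        rw [Real.norm_eq_abs]
        exact (le_of_lt (hv p)).trans (le_abs_self ε)
    _ = Real.sqrt (Fintype.card (Plaquette 4 S)) * |ε| := by
        rw [Finset.sum_const, Finset.card_univ, nsmul_eq_mul, Real.sqrt_mul (Nat.cast_nonneg _),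
          Real.sqrt_sq (abs_nonneg _)]

/-- The box has positive volume (for `ε > 0`): it contains a ball. [folklore] -/
theorem volume_boxV_pos {ε : ℝ} (hε : 0 < ε) : 0 < (volume : Measure (LinearMap.range (plaqCoboundary S))) (boxV S ε) := by
  refine lt_of_lt_of_le (Metric.measure_ball_pos volume (0 : LinearMap.range (plaqCoboundary S)) hε)
    (measure_mono fun v hv p => ?_)
  rw [Metric.mem_ball, dist_zero_right] at hv
  calc |(v : EuclideanSpace ℝ (Plaquette 4 S)) p| = ‖(v : EuclideanSpace ℝ (Plaquette 4 S)) p‖ := rfl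
    _ ≤ ‖(v : EuclideanSpace ℝ (Plaquette 4 S))‖ := PiLp.norm_apply_le _ p
    _ = ‖v‖ := (Submodule.coe_norm v).symm
    _ < ε := hv

/-- Total mass of the box measure is positive. [folklore] -/
theorem boxMeasure_univ_pos {β ε : ℝ} (hε : 0 < ε) : 0 < boxMeasure S β ε Set.univ := by
  rw [boxMeasure, withDensity_apply _ MeasurableSet.univ, Measure.restrict_univ]
  refine (lintegral_pos_iff_support ((ENNReal.measurable_ofReal.comp (measurable_cosWeight β)))).2 ?_
  have : Function.support (ENNReal.ofReal ∘ cosWeight S β) = Set.univ := by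
    ext v; simp [cosWeight_pos β v]
  rw [this, Measure.restrict_apply MeasurableSet.univ, Set.univ_inter]
  exact volume_boxV_pos hε

/-- Total mass of the box measure is finite (for `β ≥ 0`). [folklore] -/
theorem boxMeasure_univ_lt_top {β : ℝ} (hβ : 0 ≤ β) (ε : ℝ) : boxMeasure S β ε Set.univ < ∞ := by
  rw [boxMeasure, withDensity_apply _ MeasurableSet.univ, Measure.restrict_univ]
  calc ∫⁻ v in boxV S ε, ENNReal.ofReal (cosWeight S β v)
      ≤ ∫⁻ _v in boxV S ε, 1 := lintegral_mono fun v => by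
        rw [← ENNReal.ofReal_one]; exact ENNReal.ofReal_le_ofReal (cosWeight_le_one hβ v)
    _ = (volume : Measure (LinearMap.range (plaqCoboundary S))) (boxV S ε) := by
        rw [setLIntegral_const, one_mul]
    _ < ∞ := volume_boxV_lt_top ε

/-- `boxProb` is a probability measure (`ε > 0`, `β ≥ 0`). [folklore] -/
theorem isProbabilityMeasure_boxProb {β ε : ℝ} (hβ : 0 ≤ β) (hε : 0 < ε) : IsProbabilityMeasure (boxProb S β ε) :=
  ⟨by rw [boxProb, Measure.smul_apply, smul_eq_mul,
    ENNReal.inv_mul_cancel (boxMeasure_univ_pos hε).ne' (boxMeasure_univ_lt_top hβ ε).ne]⟩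

/-- `boxProb` lives on the box. [folklore] -/
theorem boxProb_compl_boxV (β ε : ℝ) : boxProb S β ε (boxV S ε)ᶜ = 0 := by
  rw [boxProb, Measure.smul_apply, smul_eq_mul, boxMeasure, withDensity_apply _ (measurableSet_boxV ε).compl,
    Measure.restrict_restrict (measurableSet_boxV ε).compl, Set.compl_inter_self, Measure.restrict_empty,
    lintegral_zero_measure, mul_zero]

/-- Integrals against `boxMeasure` are weighted box integrals. [folklore] -/
theorem lintegral_boxMeasure (β ε : ℝ) (F : LinearMap.range (plaqCoboundary S) → ℝ≥0∞) (hF : Measurable F) :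
    ∫⁻ v, F v ∂(boxMeasure S β ε) = ∫⁻ v in boxV S ε, F v * ENNReal.ofReal (cosWeight S β v) := by
  rw [boxMeasure, lintegral_withDensity_eq_lintegral_mul _
    (show Measurable (fun v => ENNReal.ofReal (cosWeight S β v)) from
      ENNReal.measurable_ofReal.comp (measurable_cosWeight β)) hF]
  refine lintegral_congr fun v => ?_
  simp [mul_comm]

/-- **Chart identity, unconditional form.**  For admissible `ε` (`ε ≤ π`, `S⁴ε ≤ 2π`, `6ε ≤ 2π`), every `β` and
measurable `F ≥ 0`: `∫_{G_ε} F(ω(U)) dμ_β = Z_β⁻¹ · c_S · ∫ F d(boxMeasure)` with the chart constant `c_S` of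
`WitnessChart` (landed `stub_abelianPushforward`, `stub_torusTwoFormExact` discharge its hypotheses). [folklore] -/
theorem exists_chart_constant_boxMeasure :
    ∃ c : ℝ≥0∞, c ≠ 0 ∧ c ≠ ∞ ∧ ∀ {ε : ℝ}, ε ≤ Real.pi → (S : ℝ) ^ 4 * ε ≤ 2 * Real.pi →
      6 * ε ≤ 2 * Real.pi → ∀ (β : ℝ) (F : LinearMap.range (plaqCoboundary S) → ℝ≥0∞), Measurable F →
      ∫⁻ U in {U : GaugeConfig 4 S Circle | ∀ p : Plaquette 4 S, |plaqAngle U p| < ε}, F (omegaV U)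
          ∂(wilsonMeasure u1Rep β : Measure (GaugeConfig 4 S Circle)) =
        (partitionFunction (d := 4) (L := S) u1Rep β)⁻¹ * c * ∫⁻ v, F v ∂(boxMeasure S β ε) := by
  obtain ⟨c, hc0, hctop, hc⟩ := exists_chart_constant_wilson (S := S)
    (fun n d hd => stub_abelianPushforward n d hd) (fun S _ ω h1 h2 h3 => stub_torusTwoFormExact S ω h1 h2 h3)
  refine ⟨c, hc0, hctop, fun {ε} hεπ hSε h6 β F hF => ?_⟩
  rw [hc hεπ hSε h6 β F hF, lintegral_boxMeasure β ε F hF]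
  rfl

/-- **`∫_{G_ε} F(ω(U)) dμ_β = μ_β(G_ε) · ∫ F d(boxProb)`** for admissible `ε > 0` and `β ≥ 0`. [folklore] -/
theorem lintegral_goodSet_eq_mul_boxProb {ε β : ℝ} (hε : 0 < ε) (hβ : 0 ≤ β) (hεπ : ε ≤ Real.pi)
    (hSε : (S : ℝ) ^ 4 * ε ≤ 2 * Real.pi) (h6 : 6 * ε ≤ 2 * Real.pi)
    (F : LinearMap.range (plaqCoboundary S) → ℝ≥0∞) (hF : Measurable F) :
    ∫⁻ U in {U : GaugeConfig 4 S Circle | ∀ p : Plaquette 4 S, |plaqAngle U p| < ε}, F (omegaV U)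
        ∂(wilsonMeasure u1Rep β : Measure (GaugeConfig 4 S Circle)) =
      (wilsonMeasure u1Rep β : Measure (GaugeConfig 4 S Circle))
          {U : GaugeConfig 4 S Circle | ∀ p : Plaquette 4 S, |plaqAngle U p| < ε} *
        ∫⁻ v, F v ∂(boxProb S β ε) := by
  obtain ⟨c, hc0, hctop, hc⟩ := exists_chart_constant_boxMeasure (S := S)
  have h1 := hc hεπ hSε h6 β F hF
  have h0 := hc hεπ hSε h6 β (fun _ => 1) measurable_const
  simp only [lintegral_one, Measure.restrict_apply MeasurableSet.univ, Set.univ_inter] at h0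
  rw [h1, h0, boxProb, lintegral_smul_measure, smul_eq_mul]
  have hB0 : boxMeasure S β ε Set.univ ≠ 0 := (boxMeasure_univ_pos hε).ne'
  have hBt : boxMeasure S β ε Set.univ ≠ ∞ := (boxMeasure_univ_lt_top hβ ε).ne
  set Z := (partitionFunction (d := 4) (L := S) u1Rep β)⁻¹
  set B := boxMeasure S β ε Set.univ
  set I := ∫⁻ v, F v ∂(boxMeasure S β ε)
  calc Z * c * I = Z * c * (B * B⁻¹) * I := by rw [ENNReal.mul_inv_cancel hB0 hBt, mul_one]
    _ = Z * c * B * (B⁻¹ * I) := by ring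


/-- **Push-forward of Wilson's measure on the good set**: `(μ_β|_{G_ε}) ∘ ω⁻¹ = μ_β(G_ε) · boxProb`
(admissible `ε > 0`, `β ≥ 0`). [folklore] -/
theorem map_restrict_goodSet_eq {ε β : ℝ} (hε : 0 < ε) (hβ : 0 ≤ β) (hεπ : ε ≤ Real.pi)
    (hSε : (S : ℝ) ^ 4 * ε ≤ 2 * Real.pi) (h6 : 6 * ε ≤ 2 * Real.pi) :
    ((wilsonMeasure u1Rep β : Measure (GaugeConfig 4 S Circle)).restrict
        {U : GaugeConfig 4 S Circle | ∀ p : Plaquette 4 S, |plaqAngle U p| < ε}).map omegaV =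
      (wilsonMeasure u1Rep β : Measure (GaugeConfig 4 S Circle))
          {U : GaugeConfig 4 S Circle | ∀ p : Plaquette 4 S, |plaqAngle U p| < ε} • boxProb S β ε := by
  refine Measure.ext fun A hA => ?_
  rw [Measure.map_apply measurable_omegaV hA, Measure.smul_apply, smul_eq_mul,
    Measure.restrict_apply' (measurableSet_goodSet (S := S) ε), ← lintegral_indicator_one hA,
    ← lintegral_goodSet_eq_mul_boxProb hε hβ hεπ hSε h6 (A.indicator 1) (measurable_one.indicator hA),
    ← lintegral_indicator_one ((measurable_omegaV hA).inter (measurableSet_goodSet (S := S) ε)),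
    ← lintegral_indicator (measurableSet_goodSet (S := S) ε)]
  refine lintegral_congr fun U => ?_
  by_cases h1 : U ∈ {U : GaugeConfig 4 S Circle | ∀ p : Plaquette 4 S, |plaqAngle U p| < ε}
  · by_cases h2 : omegaV U ∈ A
    · rw [Set.indicator_of_mem h1, Set.indicator_of_mem h2,
        Set.indicator_of_mem (show U ∈ omegaV ⁻¹' A ∩ _ from ⟨h2, h1⟩)]
      rfl
    · rw [Set.indicator_of_mem h1, Set.indicator_of_notMem h2,
        Set.indicator_of_notMem (show U ∉ omegaV ⁻¹' A ∩ _ from fun h => h2 h.1)]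
  · rw [Set.indicator_of_notMem h1, Set.indicator_of_notMem (show U ∉ omegaV ⁻¹' A ∩ _ from fun h => h1 h.2)]

/-- **Integrals on the good set are box-probability expectations**: for every `Ψ : V → ℝ`,
`∫_{G_ε} Ψ(ω(U)) dμ_β = μ_β(G_ε) · ∫ Ψ d(boxProb)`. [folklore] -/
theorem setIntegral_goodSet_eq_mul_boxProb {ε β : ℝ} (hε : 0 < ε) (hβ : 0 ≤ β) (hεπ : ε ≤ Real.pi)
    (hSε : (S : ℝ) ^ 4 * ε ≤ 2 * Real.pi) (h6 : 6 * ε ≤ 2 * Real.pi)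
    (Ψ : LinearMap.range (plaqCoboundary S) → ℝ) (hΨ : Measurable Ψ) :
    ∫ U in {U : GaugeConfig 4 S Circle | ∀ p : Plaquette 4 S, |plaqAngle U p| < ε}, Ψ (omegaV U)
        ∂(wilsonMeasure u1Rep β : Measure (GaugeConfig 4 S Circle)) =
      (wilsonMeasure u1Rep β : Measure (GaugeConfig 4 S Circle)).real
          {U : GaugeConfig 4 S Circle | ∀ p : Plaquette 4 S, |plaqAngle U p| < ε} *
        ∫ v, Ψ v ∂(boxProb S β ε) := by
  rw [← integral_map measurable_omegaV.aemeasurable hΨ.aestronglyMeasurable, map_restrict_goodSet_eq hε hβ hεπ hSε h6,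
    integral_smul_measure]
  rfl

/-- **Moment dictionary.**  Let `ψ` be an observable of the `U(1)` configuration that agrees on the good set
`G_ε` with `Ψ ∘ ω` for a function `Ψ` on `V`, both measurable and bounded by `M`.  Then, for admissible `ε > 0`
and `β ≥ 0`: `|E_{μ_β} ψ − E_{boxProb} Ψ| ≤ 2 M μ_β(G_εᶜ)`. [folklore] -/
theorem abs_integral_sub_integral_boxProb_le {ε β : ℝ} (hε : 0 < ε) (hβ : 0 ≤ β) (hεπ : ε ≤ Real.pi)
    (hSε : (S : ℝ) ^ 4 * ε ≤ 2 * Real.pi) (h6 : 6 * ε ≤ 2 * Real.pi)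
    {ψ : GaugeConfig 4 S Circle → ℝ} {Ψ : LinearMap.range (plaqCoboundary S) → ℝ} (hψm : Measurable ψ)
    (hΨm : Measurable Ψ) {M : ℝ} (hψ : ∀ U, |ψ U| ≤ M) (hΨ : ∀ v, |Ψ v| ≤ M)
    (hagree : ∀ U : GaugeConfig 4 S Circle, (∀ p : Plaquette 4 S, |plaqAngle U p| < ε) → ψ U = Ψ (omegaV U)) :
    |∫ U, ψ U ∂(wilsonMeasure u1Rep β : Measure (GaugeConfig 4 S Circle)) - ∫ v, Ψ v ∂(boxProb S β ε)| ≤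
      2 * M * (wilsonMeasure u1Rep β : Measure (GaugeConfig 4 S Circle)).real
        {U : GaugeConfig 4 S Circle | ∀ p : Plaquette 4 S, |plaqAngle U p| < ε}ᶜ := by
  set μ : Measure (GaugeConfig 4 S Circle) := wilsonMeasure u1Rep β with hμ
  haveI : IsProbabilityMeasure μ := isProbabilityMeasure_wilsonMeasure (L := S) u1Rep continuous_u1Rep β
  haveI : IsProbabilityMeasure (boxProb S β ε) := isProbabilityMeasure_boxProb hβ hε
  set G : Set (GaugeConfig 4 S Circle) := {U | ∀ p : Plaquette 4 S, |plaqAngle U p| < ε} with hG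
  have hGm : MeasurableSet G := measurableSet_goodSet (S := S) ε
  have hM : 0 ≤ M := (abs_nonneg _).trans (hΨ 0)
  have hint : Integrable ψ μ := Integrable.of_bound hψm.aestronglyMeasurable M
    (ae_of_all _ fun U => by rw [Real.norm_eq_abs]; exact hψ U)
  -- split the integral over `G` and `Gᶜ`
  have hsplit : ∫ U, ψ U ∂μ = ∫ U in G, ψ U ∂μ + ∫ U in Gᶜ, ψ U ∂μ := (integral_add_compl hGm hint).symm
  have hG1 : ∫ U in G, ψ U ∂μ = μ.real G * ∫ v, Ψ v ∂(boxProb S β ε) := by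
    rw [setIntegral_congr_fun hGm (fun U hU => hagree U hU)]
    exact setIntegral_goodSet_eq_mul_boxProb hε hβ hεπ hSε h6 Ψ hΨm
  have hG2 : |∫ U in Gᶜ, ψ U ∂μ| ≤ M * μ.real Gᶜ := by
    have h := norm_setIntegral_le_of_norm_le_const (μ := μ) (s := Gᶜ) (measure_lt_top μ _)
      (fun U _ => show ‖ψ U‖ ≤ M by rw [Real.norm_eq_abs]; exact hψ U)
    rw [Real.norm_eq_abs] at h
    linarith [h]
  have hE : |∫ v, Ψ v ∂(boxProb S β ε)| ≤ M := by
    have h := norm_integral_le_of_norm_le_const (μ := boxProb S β ε) (C := M)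
      (ae_of_all _ fun v => show ‖Ψ v‖ ≤ M by rw [Real.norm_eq_abs]; exact hΨ v)
    rw [Real.norm_eq_abs, probReal_univ, mul_one] at h
    exact h
  have hprob : μ.real G + μ.real Gᶜ = 1 := by
    rw [measureReal_add_measureReal_compl hGm, probReal_univ]
  rw [hsplit, hG1]
  have e : μ.real G * ∫ v, Ψ v ∂(boxProb S β ε) + ∫ U in Gᶜ, ψ U ∂μ - ∫ v, Ψ v ∂(boxProb S β ε) =
      ∫ U in Gᶜ, ψ U ∂μ - μ.real Gᶜ * ∫ v, Ψ v ∂(boxProb S β ε) := by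
    have : μ.real G = 1 - μ.real Gᶜ := by linarith
    rw [this]; ring
  rw [e]
  have h3 : |μ.real Gᶜ * ∫ v, Ψ v ∂(boxProb S β ε)| ≤ μ.real Gᶜ * M := by
    rw [abs_mul, abs_of_nonneg measureReal_nonneg]
    exact mul_le_mul_of_nonneg_left hE measureReal_nonneg
  calc |∫ U in Gᶜ, ψ U ∂μ - μ.real Gᶜ * ∫ v, Ψ v ∂(boxProb S β ε)|
      ≤ |∫ U in Gᶜ, ψ U ∂μ| + |μ.real Gᶜ * ∫ v, Ψ v ∂(boxProb S β ε)| := abs_sub _ _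
    _ ≤ M * μ.real Gᶜ + μ.real Gᶜ * M := add_le_add hG2 h3
    _ = 2 * M * μ.real Gᶜ := by ring

end Summit.QuantumFields.YangMills.Theorems.SelfNormalisedSkewness.Negative

end
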